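import Mathlib
import Literature.Analysis.PDE.InverseSquareChannelEstimate
import Literature.Analysis.PDE.Wave1DFarComparison
import Literature.Analysis.PDE.Wave1DFarSolutionSpace
import Literature.Analysis.Calculus.HardyChainHalfLine

/-!
# Coercivity of the channel energy modulo the EXACT kernel, for potentials close to `n(n+1)/x²`

Analysis/PDE support file (everything proved). Fix `n` and the smooth `ι = 1/x` on `[½,∞)` (with
smooth primitive). Let `c₀ = c₀(n) > 0` be the constant of the exact inverse-square channel estimate
(`inverseSquare_channel_estimate`). For every `0 < ε ≤ ¼`, every continuous `W ≥ 0` with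
`|W(x) − n(n+1)/x²| ≤ ε x^{−5/2}` (`x ≥ ½`) and every far solution `ψ` (global `C²`, residual
`ψ_tt − ψ_xx + Wψ = 0` on `{x ≥ 1}`, finite `W`-energy `E` on `(1,∞)` at `t = 0`) and every `δ > 0`
there is an exact-kernel datum `(P, Q)` — Darboux ladders of Taylor sums, exactly the form produced by
`inverseSquare_channel_estimate` — with

  `∫_{x>1} ((h−P)')² + W(h−P)² + (g−Q)²  ≤  (8/c₀)·(L⁺ + L⁻) + (512 ε/c₀)·E + δ`,

`(h, g)` the Cauchy data of `ψ`, `L±` its far `W`-channel limits (`farUnit_exact_modulo_kernel`).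
Ingredients: the exact estimate for the exact wave `φ₀` with the same data, the Duhamel comparison of
the channel limits of `φ₀` and `ψ` (`Wave1DFarComparison`: `κ = ε`, `κ' = 1`), and the passage from
the `n(n+1)ι²`-energy to the `W`-energy (`W ≤ (1+ε)·n(n+1)ι²` for `n ≥ 1`; for `n = 0` the kernel
constant is re-chosen as `h(1)` and Hardy's inequality `∫_1^∞ (h−h(1))²/x² ≤ 4∫ h'²` is used). This is
hypothesis `hexact` of the kernel-absorption lemma in the far-side channel estimate of
`FixedModeChannels` (route PhotonSphereChannels, stmt-FinalStateConjecture-10048).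
-/

noncomputable section

namespace Literature.Analysis.PDE

open Set Filter MeasureTheory Literature.Analysis.ODE Literature.Analysis.Calculus
open scoped _root_.Topology

variable {ι : ℝ → ℝ}

/-- The residual of a `C²` function is continuous (local copy of
`FarKernelSpanLemmas.continuous_wave1D_residual`, private to decouple build order). [folklore] -/
private theorem continuous_wave1D_residual_loc {W : ℝ → ℝ} {φ : ℝ → ℝ → ℝ} (hW : Continuous W)
    (hφ : ContDiff ℝ 2 (Function.uncurry φ)) :
    Continuous (Function.uncurry fun t x =>
      iteratedDeriv 2 (fun τ => φ τ x) t - iteratedDeriv 2 (φ t) x + W x * φ t x) := by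
  obtain ⟨-, -, φtt, -, φxx, -, -, hctt, -, hcxx, -, -, -, -, -, -, h7, h8⟩ :=
    exists_partials_of_contDiff_two hφ
  have : (Function.uncurry fun t x =>
      iteratedDeriv 2 (fun τ => φ τ x) t - iteratedDeriv 2 (φ t) x + W x * φ t x)
      = fun p : ℝ × ℝ => φtt p.1 p.2 - φxx p.1 p.2 + W p.2 * φ p.1 p.2 := by
    funext p; simp only [Function.uncurry, h7, h8]
  rw [this]
  exact (hctt.sub hcxx).add ((hW.comp continuous_snd).mul hφ.continuous)

/-- Elementary consequences of `|W − n(n+1)/x²| ≤ ε x^{−5/2}` on `[1,∞)` (`0 ≤ ε ≤ ¼`, `W ≥ 0`):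
with `V₀ = n(n+1)/x²`: `V₀ ≤ 2W`, `(V₀ − W)² ≤ ε x^{−5/2} W`, `W ≤ V₀ + ε x⁻²`, and
`W ≤ (1+ε) V₀` when `n ≥ 1`. [folklore] -/
theorem nearInverseSquare_pointwise {W : ℝ → ℝ} {n : ℕ} {ε : ℝ} (hε0 : 0 ≤ ε) (hε : ε ≤ 1 / 4)
    (hW0 : ∀ x, 0 ≤ W x)
    (hclose : ∀ x : ℝ, 1 / 2 ≤ x → |W x - (n : ℝ) * ((n : ℝ) + 1) / x ^ 2| ≤ ε * x ^ (-(5 : ℝ) / 2))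
    {x : ℝ} (hx : 1 ≤ x) :
    (n : ℝ) * ((n : ℝ) + 1) / x ^ 2 ≤ 2 * W x ∧
    ((n : ℝ) * ((n : ℝ) + 1) / x ^ 2 - W x) ^ 2 ≤ ε * x ^ (-(5 : ℝ) / 2) * W x ∧
    W x ≤ (n : ℝ) * ((n : ℝ) + 1) / x ^ 2 + ε * (x ^ 2)⁻¹ ∧
    (1 ≤ n → W x ≤ (1 + ε) * ((n : ℝ) * ((n : ℝ) + 1) / x ^ 2)) := by
  set V : ℝ := (n : ℝ) * ((n : ℝ) + 1) / x ^ 2 with hV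
  have hx0 : 0 < x := by linarith
  have hc := abs_le.1 (hclose x (by linarith))
  have hpow : x ^ (-(5 : ℝ) / 2) ≤ (x ^ 2)⁻¹ := by
    have h1 : x ^ (-(5 : ℝ) / 2) ≤ x ^ (-(2 : ℝ)) :=
      Real.rpow_le_rpow_of_exponent_le hx (by norm_num)
    rw [Real.rpow_neg hx0.le, show (2 : ℝ) = ((2 : ℕ) : ℝ) by norm_num, Real.rpow_natCast] at h1
    exact h1
  have hpow1 : x ^ (-(5 : ℝ) / 2) ≤ 1 := by
    refine hpow.trans ?_
    rw [inv_le_one₀ (by positivity)]; nlinarith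
  have hpow0 : 0 ≤ x ^ (-(5 : ℝ) / 2) := Real.rpow_nonneg hx0.le _
  have hV0 : 0 ≤ V := by rw [hV]; positivity
  have hWx := hW0 x
  -- `ε x^{-5/2} ≤ ε/x² ≤ V/2` when `n ≥ 1`; for `n = 0`, `V = 0`
  have hεx : ε * x ^ (-(5 : ℝ) / 2) ≤ ε * (x ^ 2)⁻¹ := mul_le_mul_of_nonneg_left hpow hε0
  have hkey : (n : ℝ) = 0 ∨ ε * x ^ (-(5 : ℝ) / 2) ≤ V / 2 := by
    rcases Nat.eq_zero_or_pos n with h0 | hpos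
    · left; exact_mod_cast h0
    · right
      have hn1 : (1 : ℝ) ≤ (n : ℝ) * ((n : ℝ) + 1) := by
        have : (1 : ℝ) ≤ n := by exact_mod_cast hpos
        nlinarith
      have : ε * (x ^ 2)⁻¹ ≤ V / 2 := by
        rw [hV]
        have e1 : ε * (x ^ 2)⁻¹ = ε / x ^ 2 := by rw [div_eq_mul_inv]
        have e2 : (n : ℝ) * ((n : ℝ) + 1) / x ^ 2 / 2 = ((n : ℝ) * ((n : ℝ) + 1) / 2) / x ^ 2 := by
          ring
        rw [e1, e2]
        exact div_le_div_of_nonneg_right (by linarith) (by positivity)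
      exact hεx.trans this
  refine ⟨?_, ?_, ?_, ?_⟩
  · rcases hkey with h0 | h
    · have : V = 0 := by rw [hV, h0]; simp
      rw [this]; linarith
    · linarith [hc.1]
  · -- `|W − V| ≤ W`, then `(V−W)² = |W−V|·|W−V| ≤ ε x^{-5/2} · W`
    have habs : |W x - V| ≤ ε * x ^ (-(5 : ℝ) / 2) := abs_le.2 ⟨hc.1, hc.2⟩
    have hle : |W x - V| ≤ W x := by
      rcases hkey with h0 | h
      · have : V = 0 := by rw [hV, h0]; simp
        rw [this, sub_zero, abs_of_nonneg hWx]
      · have : V - ε * x ^ (-(5 : ℝ) / 2) ≤ W x := by linarith [hc.1]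
        refine abs_le.2 ⟨by linarith, by linarith⟩
    have e : (V - W x) ^ 2 = |W x - V| * |W x - V| := by
      rw [← sq, sq_abs]; ring
    rw [e]
    exact mul_le_mul habs hle (abs_nonneg _) (by positivity)
  · linarith [hc.2]
  · intro hn
    have hn1 : (1 : ℝ) ≤ (n : ℝ) * ((n : ℝ) + 1) := by
      have : (1 : ℝ) ≤ n := by exact_mod_cast hn
      nlinarith
    have h1 : ε * (x ^ 2)⁻¹ ≤ ε * V := by
      refine mul_le_mul_of_nonneg_left ?_ hε0
      rw [hV, div_eq_mul_inv]
      have : 0 ≤ (x ^ 2)⁻¹ := by positivity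
      nlinarith
    linarith [hc.2]

/-- Hardy at the left end of `(1, X)`: for `h ∈ C¹`, `∫_1^X (h − h 1)²/x² ≤ 4 ∫_1^X h'²`.
[folklore] -/
theorem hardy_sub_left_value {h : ℝ → ℝ} (hh : ContDiff ℝ 1 h) {X : ℝ} (hX : 1 ≤ X) :
    ∫ x in (1 : ℝ)..X, (h x - h 1) ^ 2 / x ^ 2 ≤ 4 * ∫ x in (1 : ℝ)..X, deriv h x ^ 2 := by
  have hd : ∀ r ∈ Icc (1 : ℝ) X, HasDerivAt (fun y => h y - h 1) (deriv h r) r := fun r _ =>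
    ((hh.differentiable one_ne_zero) r).hasDerivAt.sub_const _
  have h0 := hardy_sq_div_pow_le (Φ := fun y => h y - h 1) (Φ' := deriv h) one_pos hX hd
    ((hh.continuous_deriv le_rfl).continuousOn) (by simp) 0
  simp only [Nat.mul_zero, zero_add, pow_zero, div_one] at h0
  exact h0

/-- **Coercivity modulo the exact kernel in the `W`-energy.** See the module docstring.
[folklore] -/
theorem farUnit_exact_modulo_kernel (hι : ContDiff ℝ (⊤ : ℕ∞) ι)
    (hιeq : ∀ x : ℝ, 1 / 2 ≤ x → ι x = x⁻¹) {I : ℝ → ℝ} (hI : ContDiff ℝ (⊤ : ℕ∞) I)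
    (hI' : ∀ x, HasDerivAt I (ι x) x) (n : ℕ) :
    ∃ c₀ : ℝ, 0 < c₀ ∧ ∀ (ε : ℝ), 0 < ε → ε ≤ 1 / 4 → ∀ (W : ℝ → ℝ), Continuous W →
      (∀ x, 0 ≤ W x) →
      (∀ x : ℝ, 1 / 2 ≤ x → |W x - (n : ℝ) * ((n : ℝ) + 1) / x ^ 2| ≤ ε * x ^ (-(5 : ℝ) / 2)) →
      ∀ (ψ : ℝ → ℝ → ℝ), ContDiff ℝ 2 (Function.uncurry ψ) →
      (∀ t x, 1 ≤ x →
        iteratedDeriv 2 (fun τ => ψ τ x) t - iteratedDeriv 2 (ψ t) x + W x * ψ t x = 0) →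
      IntegrableOn (fun x => deriv (fun τ => ψ τ x) 0 ^ 2 + deriv (ψ 0) x ^ 2
        + W x * ψ 0 x ^ 2) (Ioi 1) →
      ∀ δ : ℝ, 0 < δ → ∃ ch cg : ℕ → ℝ,
        IntegrableOn (fun x =>
          deriv (fun y => ψ 0 y - ladder ι n (fun z => ∑ m ∈ Finset.range (n + 1),
            ch m / m.factorial * (z - 1) ^ m) y) x ^ 2
          + W x * (ψ 0 x - ladder ι n (fun z => ∑ m ∈ Finset.range (n + 1),
            ch m / m.factorial * (z - 1) ^ m) x) ^ 2
          + (deriv (fun τ => ψ τ x) 0 - ladder ι n (fun z => ∑ m ∈ Finset.range n,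
            cg m / m.factorial * (z - 1) ^ m) x) ^ 2) (Ioi 1) ∧
        ∫ x in Ioi 1, (deriv (fun y => ψ 0 y - ladder ι n (fun z => ∑ m ∈ Finset.range (n + 1),
            ch m / m.factorial * (z - 1) ^ m) y) x ^ 2
          + W x * (ψ 0 x - ladder ι n (fun z => ∑ m ∈ Finset.range (n + 1),
            ch m / m.factorial * (z - 1) ^ m) x) ^ 2
          + (deriv (fun τ => ψ τ x) 0 - ladder ι n (fun z => ∑ m ∈ Finset.range n,
            cg m / m.factorial * (z - 1) ^ m) x) ^ 2)
        ≤ (8 / c₀) * (limUnder atTop (fun t => ∫ x in Ioi (1 + |t|),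
              (deriv (fun τ => ψ τ x) t ^ 2 + deriv (ψ t) x ^ 2 + W x * ψ t x ^ 2))
            + limUnder atBot (fun t => ∫ x in Ioi (1 + |t|),
              (deriv (fun τ => ψ τ x) t ^ 2 + deriv (ψ t) x ^ 2 + W x * ψ t x ^ 2)))
          + (512 * ε / c₀) * (∫ x in Ioi 1, (deriv (fun τ => ψ τ x) 0 ^ 2 + deriv (ψ 0) x ^ 2
            + W x * ψ 0 x ^ 2)) + δ := by
  obtain ⟨c₀, hc₀, hA⟩ := inverseSquare_channel_estimate hι hιeq hI hI' n
  refine ⟨c₀, hc₀, ?_⟩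
  intro ε hε hε4 W hW hW0 hclose ψ hψ hres hint δ hδ
  set V₀ : ℝ → ℝ := fun x => (n : ℝ) * ((n : ℝ) + 1) * ι x ^ 2 with hV₀
  have hV₀c : Continuous V₀ := continuous_const.mul (hι.continuous.pow 2)
  have hV₀0 : ∀ x, 0 ≤ V₀ x := fun x => by simp only [hV₀]; positivity
  have hV₀eq : ∀ x, 1 ≤ x → V₀ x = (n : ℝ) * ((n : ℝ) + 1) / x ^ 2 := fun x hx => by
    simp only [hV₀, hιeq x (by linarith), inv_pow]; rw [div_eq_mul_inv]
  have hpt := fun x (hx : (1 : ℝ) ≤ x) => nearInverseSquare_pointwise (n := n) hε.le hε4 hW0 hclose hx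
  -- the data and its regularity / integrability
  obtain ⟨hgc, hg1, hi₁, hi₂, hi₃⟩ := farEnergy_pieces hW hW0 hψ 0 (S := Ioi 1)
    (by simpa only [abs_zero, add_zero] using hint)
  have hh2 : ContDiff ℝ 2 (ψ 0) := hψ.comp (contDiff_const.prodMk contDiff_id)
  have hiV₀ : IntegrableOn (fun x => (n : ℝ) * ((n : ℝ) + 1) * ι x ^ 2 * ψ 0 x ^ 2) (Ioi 1) := by
    refine Integrable.mono' (hi₂.const_mul 2) ((hV₀c.mul (hh2.continuous.pow 2)).aestronglyMeasurable)
      ((ae_restrict_iff' measurableSet_Ioi).2 (ae_of_all _ fun x hx => ?_))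
    have hx : (1 : ℝ) ≤ x := le_of_lt hx
    rw [Real.norm_eq_abs, abs_of_nonneg (mul_nonneg (hV₀0 x) (sq_nonneg _))]
    have h1 := (hpt x hx).1
    rw [← hV₀eq x hx] at h1
    have : V₀ x * ψ 0 x ^ 2 ≤ 2 * W x * ψ 0 x ^ 2 := mul_le_mul_of_nonneg_right h1 (sq_nonneg _)
    simp only [hV₀] at this ⊢
    linarith
  obtain ⟨φ₀, Lp₀, Lm₀, hφ₀C, hφ₀sol, hφ₀0, hφ₀1, hLp₀0, hLm₀0, hTp₀, hTm₀, hkernel⟩ :=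
    hA (ψ 0) (fun x => deriv (fun τ => ψ τ x) 0) hh2 hg1 hi₁ hiV₀ hi₃
  obtain ⟨-, hEt, hTp, hTm, hLp0, hLm0⟩ := farSol_energy hW hW0 hψ hres hint
  set Lp : ℝ := limUnder atTop (fun t => ∫ x in Ioi (1 + |t|),
    (deriv (fun τ => ψ τ x) t ^ 2 + deriv (ψ t) x ^ 2 + W x * ψ t x ^ 2)) with hLp
  set Lm : ℝ := limUnder atBot (fun t => ∫ x in Ioi (1 + |t|),
    (deriv (fun τ => ψ τ x) t ^ 2 + deriv (ψ t) x ^ 2 + W x * ψ t x ^ 2)) with hLm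
  set E : ℝ := ∫ x in Ioi 1, (deriv (fun τ => ψ τ x) 0 ^ 2 + deriv (ψ 0) x ^ 2 + W x * ψ 0 x ^ 2)
    with hEdef
  have hE0 : 0 ≤ E := setIntegral_nonneg measurableSet_Ioi fun x _ => wave1D_energyDensity_nonneg hW0 0 x
  -- Duhamel comparison of the limits: `Lp₀ + Lm₀ ≤ 4 (Lp + Lm) + 256 ε E`
  have hcomp : Lp₀ + Lm₀ ≤ 2 * (1 + 1) * (Lp + Lm) + 256 * ε * E := by
    have hFc := continuous_wave1D_residual_loc hW hψ
    have hGc := continuous_wave1D_residual_loc hV₀c hφ₀C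
    have hG0 : ∀ τ x, (1 : ℝ) ≤ x → iteratedDeriv 2 (fun σ => φ₀ σ x) τ - iteratedDeriv 2 (φ₀ τ) x
        + V₀ x * φ₀ τ x = 0 := by
      intro τ x hx
      rw [hφ₀sol τ x (show (1 / 2 : ℝ) < x by linarith)]
      simp only [hV₀]; ring
    refine wave1D_farComparison_limits (W := W) (W₀ := V₀) (F := fun t x =>
        iteratedDeriv 2 (fun τ => ψ τ x) t - iteratedDeriv 2 (ψ t) x + W x * ψ t x)
      (G := fun t x => iteratedDeriv 2 (fun τ => φ₀ τ x) t - iteratedDeriv 2 (φ₀ t) x + V₀ x * φ₀ t x)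
      hW hW0 hV₀c hV₀0 hε.le (fun x hx => ?_) hFc hψ (fun t x => rfl) hres hint rfl hφ₀C
      (fun t x => rfl) hG0 hφ₀0 hφ₀1 zero_le_one (fun x hx => ?_) hTp hTm ?_ ?_
    · rw [hV₀eq x hx]; exact (hpt x hx).2.1
    · rw [hV₀eq x hx]; linarith [(hpt x hx).1, hW0 x]
    · simpa only [hV₀] using hTp₀
    · simpa only [hV₀] using hTm₀
  -- the kernel datum from the exact estimate, with `δ₁ = c₀ δ / 2`
  obtain ⟨ch, cg, hkd⟩ := hkernel (c₀ * δ / 2) (by positivity)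
  set P : ℝ → ℝ := ladder ι n (fun z => ∑ m ∈ Finset.range (n + 1),
    ch m / m.factorial * (z - 1) ^ m) with hP
  set Q : ℝ → ℝ := ladder ι n (fun z => ∑ m ∈ Finset.range n,
    cg m / m.factorial * (z - 1) ^ m) with hQ
  have hPC : ContDiff ℝ 2 P := contDiff_ladder hι (m := 2)
    ((contDiff_taylorSum ch n 1).of_le (by exact_mod_cast le_top))
  have hQC : ContDiff ℝ 1 Q := by
    refine contDiff_ladder hι (m := 1) ?_
    cases n with
    | zero => simp; exact contDiff_const
    | succ k => exact (contDiff_taylorSum cg k 1).of_le (by exact_mod_cast le_top)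
  -- the target bound `B` on every `[1, X]`
  set B : ℝ := (1 + 4 * ε) * ((Lp₀ + Lm₀ + c₀ * δ / 2) / c₀) with hB
  have hkd' : ∀ X, 1 ≤ X → ∫ x in (1 : ℝ)..X, (deriv (fun y => ψ 0 y - P y) x ^ 2
      + (n : ℝ) * (n + 1) * ι x ^ 2 * (ψ 0 x - P x) ^ 2
      + (deriv (fun τ => ψ τ x) 0 - Q x) ^ 2) ≤ (Lp₀ + Lm₀ + c₀ * δ / 2) / c₀ := by
    intro X hX
    rw [le_div_iff₀ hc₀, mul_comm]
    exact hkd X hX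
  -- the modified kernel datum: for `n = 0` replace the constant by `h 1`
  set ch' : ℕ → ℝ := if n = 0 then fun _ => ψ 0 1 else ch with hch'
  set P' : ℝ → ℝ := ladder ι n (fun z => ∑ m ∈ Finset.range (n + 1),
    ch' m / m.factorial * (z - 1) ^ m) with hP'
  have hP'C : ContDiff ℝ 2 P' := contDiff_ladder hι (m := 2)
    ((contDiff_taylorSum ch' n 1).of_le (by exact_mod_cast le_top))
  -- the `W`-energy density of the reduced data and its bound on `[1, X]`
  set dens : ℝ → ℝ := fun x => deriv (fun y => ψ 0 y - P' y) x ^ 2 + W x * (ψ 0 x - P' x) ^ 2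
    + (deriv (fun τ => ψ τ x) 0 - Q x) ^ 2 with hdens
  have hdens_c : Continuous dens :=
    (((hh2.sub hP'C).continuous_deriv (by norm_num)).pow 2 |>.add
      ((hW.mul ((hh2.continuous.sub hP'C.continuous).pow 2)))).add ((hgc.sub hQC.continuous).pow 2)
  have hdens_nn : ∀ x, 0 ≤ dens x := fun x => by
    simp only [hdens]; have := hW0 x; positivity
  have hbound : ∀ X, 1 ≤ X → ∫ x in (1 : ℝ)..X, dens x ≤ B := by
    intro X hX
    rcases Nat.eq_zero_or_pos n with hn0 | hnpos
    · ------------------------------------------------------------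
      -- `n = 0`: `P' = h 1` (constant), `Q = 0`; Hardy
      subst hn0
      have hP'eq : P' = fun _ => ψ 0 1 := by
        simp only [hP', hch']
        funext z; simp
      have hQeq : Q = fun _ => 0 := by
        simp only [hQ]; funext z; simp
      have hPconst : ∀ x, deriv (fun y => ψ 0 y - P y) x = deriv (ψ 0) x := by
        intro x
        have : P = fun _ => ch 0 := by simp only [hP]; funext z; simp
        rw [this, deriv_sub_const]
      have hP'const : ∀ x, deriv (fun y => ψ 0 y - P' y) x = deriv (ψ 0) x := by
        intro x; rw [hP'eq, deriv_sub_const]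
      -- the exact bound reads `∫_1^X h'² + g² ≤ …`
      have hex : ∫ x in (1 : ℝ)..X, (deriv (ψ 0) x ^ 2 + deriv (fun τ => ψ τ x) 0 ^ 2)
          ≤ (Lp₀ + Lm₀ + c₀ * δ / 2) / c₀ := by
        have h := hkd' X hX
        have e : ∀ x, deriv (fun y => ψ 0 y - P y) x ^ 2
            + ((0 : ℕ) : ℝ) * ((0 : ℕ) + 1) * ι x ^ 2 * (ψ 0 x - P x) ^ 2
            + (deriv (fun τ => ψ τ x) 0 - Q x) ^ 2
            = deriv (ψ 0) x ^ 2 + deriv (fun τ => ψ τ x) 0 ^ 2 := by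
          intro x; rw [hPconst x, hQeq]; push_cast; ring
        simp only [e] at h
        exact h
      -- Hardy for the potential term
      have hhardy := hardy_sub_left_value (hh2.of_le (by norm_num)) hX
      have hWle : ∀ x ∈ Icc (1 : ℝ) X, W x * (ψ 0 x - ψ 0 1) ^ 2
          ≤ ε * ((ψ 0 x - ψ 0 1) ^ 2 / x ^ 2) := by
        intro x hx
        have h3 := (hpt x hx.1).2.2.1
        simp only [Nat.cast_zero, zero_mul, zero_div, zero_add] at h3
        have : W x * (ψ 0 x - ψ 0 1) ^ 2 ≤ ε * (x ^ 2)⁻¹ * (ψ 0 x - ψ 0 1) ^ 2 :=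
          mul_le_mul_of_nonneg_right h3 (sq_nonneg _)
        rw [div_eq_mul_inv]; linarith
      have hdens_eq : ∀ x, dens x = deriv (ψ 0) x ^ 2 + W x * (ψ 0 x - ψ 0 1) ^ 2
          + deriv (fun τ => ψ τ x) 0 ^ 2 := by
        intro x; simp only [hdens, hP'eq, hQeq, sub_zero, deriv_sub_const]
      have c1 : Continuous fun x => deriv (ψ 0) x ^ 2 + deriv (fun τ => ψ τ x) 0 ^ 2 :=
        ((hh2.continuous_deriv (by norm_num)).pow 2).add (hgc.pow 2)
      have c2 : Continuous fun x => W x * (ψ 0 x - ψ 0 1) ^ 2 :=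
        hW.mul ((hh2.continuous.sub continuous_const).pow 2)
      have c4 : ContinuousOn (fun x => ε * ((ψ 0 x - ψ 0 1) ^ 2 / x ^ 2)) (uIcc 1 X) := by
        refine continuousOn_const.mul ((((hh2.continuous.sub continuous_const).pow 2).continuousOn).div
          (continuous_pow 2).continuousOn fun x hx => ?_)
        rw [uIcc_of_le hX] at hx
        exact pow_ne_zero 2 (by linarith [hx.1])
      have hsplit : ∫ x in (1 : ℝ)..X, dens x = (∫ x in (1 : ℝ)..X, (deriv (ψ 0) x ^ 2
          + deriv (fun τ => ψ τ x) 0 ^ 2)) + ∫ x in (1 : ℝ)..X, W x * (ψ 0 x - ψ 0 1) ^ 2 := by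
        rw [← intervalIntegral.integral_add (c1.intervalIntegrable _ _) (c2.intervalIntegrable _ _)]
        exact intervalIntegral.integral_congr fun x _ => by rw [hdens_eq x]; ring
      have hWint : ∫ x in (1 : ℝ)..X, W x * (ψ 0 x - ψ 0 1) ^ 2
          ≤ 4 * ε * ∫ x in (1 : ℝ)..X, (deriv (ψ 0) x ^ 2 + deriv (fun τ => ψ τ x) 0 ^ 2) := by
        calc ∫ x in (1 : ℝ)..X, W x * (ψ 0 x - ψ 0 1) ^ 2
            ≤ ∫ x in (1 : ℝ)..X, ε * ((ψ 0 x - ψ 0 1) ^ 2 / x ^ 2) :=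
              intervalIntegral.integral_mono_on hX (c2.intervalIntegrable _ _)
                (c4.intervalIntegrable) hWle
          _ = ε * ∫ x in (1 : ℝ)..X, (ψ 0 x - ψ 0 1) ^ 2 / x ^ 2 :=
              intervalIntegral.integral_const_mul _ _
          _ ≤ ε * (4 * ∫ x in (1 : ℝ)..X, deriv (ψ 0) x ^ 2) :=
              mul_le_mul_of_nonneg_left hhardy hε.le
          _ ≤ ε * (4 * ∫ x in (1 : ℝ)..X, (deriv (ψ 0) x ^ 2 + deriv (fun τ => ψ τ x) 0 ^ 2)) := by
              gcongr
              exact intervalIntegral.integral_mono_on hX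
                (((hh2.continuous_deriv (by norm_num)).pow 2).intervalIntegrable _ _)
                (c1.intervalIntegrable _ _) fun x _ => by nlinarith [sq_nonneg (deriv (fun τ => ψ τ x) 0)]
          _ = _ := by ring
      have hI0 : 0 ≤ ∫ x in (1 : ℝ)..X, (deriv (ψ 0) x ^ 2 + deriv (fun τ => ψ τ x) 0 ^ 2) :=
        intervalIntegral.integral_nonneg hX fun x _ => by positivity
      rw [hsplit]
      calc (∫ x in (1 : ℝ)..X, (deriv (ψ 0) x ^ 2 + deriv (fun τ => ψ τ x) 0 ^ 2))
            + ∫ x in (1 : ℝ)..X, W x * (ψ 0 x - ψ 0 1) ^ 2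
          ≤ (1 + 4 * ε) * ∫ x in (1 : ℝ)..X, (deriv (ψ 0) x ^ 2 + deriv (fun τ => ψ τ x) 0 ^ 2) := by
            linarith
        _ ≤ (1 + 4 * ε) * ((Lp₀ + Lm₀ + c₀ * δ / 2) / c₀) :=
            mul_le_mul_of_nonneg_left hex (by linarith)
        _ = B := by rw [hB]
    · ------------------------------------------------------------
      -- `n ≥ 1`: `P' = P`, and `W ≤ (1+ε) V₀`
      have hn0 : n ≠ 0 := by omega
      have hch'eq : ch' = ch := by simp only [hch', if_neg hn0]
      have hP'eq : P' = P := by simp only [hP', hP, hch'eq]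
      set e₀ : ℝ → ℝ := fun x => deriv (fun y => ψ 0 y - P y) x ^ 2
        + (n : ℝ) * (n + 1) * ι x ^ 2 * (ψ 0 x - P x) ^ 2
        + (deriv (fun τ => ψ τ x) 0 - Q x) ^ 2 with he₀
      have hle : ∀ x ∈ Icc (1 : ℝ) X, dens x ≤ (1 + ε) * e₀ x := by
        intro x hx
        have h4 := (hpt x hx.1).2.2.2 (Nat.one_le_iff_ne_zero.2 hn0)
        have hιx : ι x ^ 2 = (x ^ 2)⁻¹ := by rw [hιeq x (by linarith [hx.1]), inv_pow]
        simp only [hdens, he₀, hP'eq]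
        have hW' : W x ≤ (1 + ε) * ((n : ℝ) * ((n : ℝ) + 1) * ι x ^ 2) := by
          rw [hιx, ← div_eq_mul_inv]; exact h4
        have t1 : W x * (ψ 0 x - P x) ^ 2 ≤ (1 + ε) * ((n : ℝ) * ((n : ℝ) + 1) * ι x ^ 2)
            * (ψ 0 x - P x) ^ 2 := mul_le_mul_of_nonneg_right hW' (sq_nonneg _)
        have t2 : 0 ≤ deriv (fun y => ψ 0 y - P y) x ^ 2 := sq_nonneg _
        have t3 : 0 ≤ (deriv (fun τ => ψ τ x) 0 - Q x) ^ 2 := sq_nonneg _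
        nlinarith [t1, t2, t3, hε.le]
      have ce₀ : Continuous e₀ :=
        ((((hh2.sub hPC).continuous_deriv (by norm_num)).pow 2).add
          ((continuous_const.mul (hι.continuous.pow 2)).mul ((hh2.continuous.sub hPC.continuous).pow 2))).add
          ((hgc.sub hQC.continuous).pow 2)
      have he₀0 : 0 ≤ ∫ x in (1 : ℝ)..X, e₀ x :=
        intervalIntegral.integral_nonneg hX fun x _ => by simp only [he₀]; positivity
      calc ∫ x in (1 : ℝ)..X, dens x ≤ ∫ x in (1 : ℝ)..X, (1 + ε) * e₀ x :=
            intervalIntegral.integral_mono_on hX (hdens_c.intervalIntegrable _ _)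
              ((ce₀.const_mul _).intervalIntegrable _ _) hle
        _ = (1 + ε) * ∫ x in (1 : ℝ)..X, e₀ x := intervalIntegral.integral_const_mul _ _
        _ ≤ (1 + ε) * ((Lp₀ + Lm₀ + c₀ * δ / 2) / c₀) :=
            mul_le_mul_of_nonneg_left (hkd' X hX) (by linarith)
        _ ≤ B := by
            rw [hB]
            refine mul_le_mul_of_nonneg_right (by linarith) ?_
            exact le_trans he₀0 (hkd' X hX)
  -- the improper integral and the final arithmetic
  have hintd : IntegrableOn dens (Ioi 1) := by
    refine integrableOn_Ioi_of_intervalIntegral_norm_bounded B 1 (l := atTop) (b := id)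
      (fun X => (hdens_c.integrableOn_Icc).mono_set Ioc_subset_Icc_self) tendsto_id ?_
    filter_upwards [eventually_ge_atTop (1 : ℝ)] with X hX
    have : ∫ x in (1 : ℝ)..id X, ‖dens x‖ = ∫ x in (1 : ℝ)..X, dens x :=
      intervalIntegral.integral_congr fun x _ => by rw [Real.norm_eq_abs, abs_of_nonneg (hdens_nn x)]
    rw [this]; exact hbound X hX
  have hlim : Tendsto (fun X => ∫ x in (1 : ℝ)..X, dens x) atTop (𝓝 (∫ x in Ioi 1, dens x)) :=
    intervalIntegral_tendsto_integral_Ioi 1 hintd tendsto_id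
  have hfinal : ∫ x in Ioi 1, dens x ≤ B :=
    le_of_tendsto hlim ((eventually_ge_atTop (1 : ℝ)).mono fun X hX => hbound X hX)
  refine ⟨ch', cg, hintd, hfinal.trans ?_⟩
  -- `B ≤ (8/c₀)(Lp + Lm) + (512 ε/c₀) E + δ`
  have hLsum : 0 ≤ Lp + Lm := add_nonneg hLp0 hLm0
  have h14 : 1 + 4 * ε ≤ 2 := by linarith
  have hB' : B = (1 + 4 * ε) / c₀ * (Lp₀ + Lm₀) + (1 + 4 * ε) * δ / 2 := by
    rw [hB]; field_simp
  rw [hB']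
  have s1 : (1 + 4 * ε) / c₀ * (Lp₀ + Lm₀) ≤ (2 / c₀) * (2 * (1 + 1) * (Lp + Lm) + 256 * ε * E) := by
    have h1 : (1 + 4 * ε) / c₀ ≤ 2 / c₀ := div_le_div_of_nonneg_right h14 hc₀.le
    have h2 : 0 ≤ Lp₀ + Lm₀ := add_nonneg hLp₀0 hLm₀0
    calc (1 + 4 * ε) / c₀ * (Lp₀ + Lm₀) ≤ (2 / c₀) * (Lp₀ + Lm₀) := mul_le_mul_of_nonneg_right h1 h2
      _ ≤ (2 / c₀) * (2 * (1 + 1) * (Lp + Lm) + 256 * ε * E) :=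
          mul_le_mul_of_nonneg_left hcomp (by positivity)
  have s2 : (1 + 4 * ε) * δ / 2 ≤ δ := by nlinarith
  have e3 : (2 / c₀) * (2 * (1 + 1) * (Lp + Lm) + 256 * ε * E)
      = 8 / c₀ * (Lp + Lm) + 512 * ε / c₀ * E := by field_simp; ring
  linarith [s1, s2, e3]

end Literature.Analysis.PDE
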